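import Mathlib.LinearAlgebra.BilinearForm.Orthogonal
import Mathlib.LinearAlgebra.FiniteDimensional.Lemmas
import Literature.Computability.AlgebraicComplexity.AlperBogartVelascoSubspace
import Literature.Computability.AlgebraicComplexity.OrbitClosureProofs
import Literature.Computability.AlgebraicComplexity.HessianRank
import Summits.ValiantsHypothesis.ValiantsHypothesis.Theorems.RefutationDegreeBeyondHessianSosHessianToolkit

/-!
# Crux `RefutationDegree.BeyondHessianSos` (stmt-ValiantsHypothesis-5643), line `Sketch` —
# Mignon–Ressayre plus one: `dc(per_n) ≥ ⌈n²/2⌉ + 1`, and the semantic half of the crux for odd `n`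

The crux asks for low-degree Hermitian-SOS refutations of the system `Rep(n, ⌊n²/2⌋+1)`
("`per_n = det` of an affine pencil of size `⌊n²/2⌋ + 1`") for all large `n`; by soundness such a
refutation can exist only if the system is infeasible, i.e. only if `dc(per_n) ≥ ⌊n²/2⌋ + 2`,
which is one (odd `n`) resp. two (even `n`) more than the Mignon–Ressayre bound `n² ≤ 2 dc(per_n)`
(`Literature…sq_le_two_mul_of_hasDetRepr_perPoly`).  This file proves the `+1`:

* `sq_add_two_le_two_mul_of_hasDetRepr_perPoly` — **`n² + 2 ≤ 2M` for every affine determinantal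
  representation of `per_n` of size `M`, `n ≥ 3`, over any field of characteristic `0`**;
* `sq_div_two_add_one_le_of_hasDetRepr_perPoly` — floor form `⌊n²/2⌋ + 1 + (n mod 2) ≤ M`;
* `not_hasDetRepr_perPoly_sq_div_two_add_one_of_odd` — **for odd `n ≥ 3`, `Rep(n, ⌊n²/2⌋+1)` is
  infeasible** (the semantic content of `BeyondHessianSos` / `BeyondHessianNs` on the odd
  subsequence; what remains there is the certificate DEGREE);
* `sq_div_two_add_one_le_determinantalComplexity_perPoly` — `dc(per_n) ≥ ⌈n²/2⌉ + 1` over `ℂ`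
  (`n = 4`: `9`, agreeing with Alper–Bogart–Velasco; `n = 5, 6, 7`: `14, 19, 26`).

## The argument (`sq_add_two_le_two_mul_of_vecMul_ne_zero`)

Let `per = det A`, `A` affine of size `M`, and let `κ ≠ 0` be a left-kernel vector of `A(0)`
(`per(0) = 0`).  By `EvenTransfer.exists_vecMul_map_eval_ne_zero` (stub file `…StubEvenTransfer.lean`) and the diagonal symmetry
`per ∘ (e × e) = per` (`rename_perPoly_equiv`) we may assume `κ A(y₀) ≠ 0` at the Mignon–Ressayre
point `y₀`.  Translate to `y₀` and pick a left-kernel vector `c ≠ 0` of `N = A(y₀)`.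
(1) REGULARITY (von zur Gathen / Alper–Bogart–Velasco Prop. 2.1, in tree as
`AlperBogartVelasco.le_rank_map_eval_add_one`): `rank A(0) ≥ M - 1`, so the left kernel of `A(0)`
is the line `K κ`; since `κ N ≠ 0 = c N`, `c ∉ K κ`, hence `c A(0) ≠ 0`.
(2) KERNEL FLAT: `K' := {v : c L(v) = 0}` (`L` = linear part of `A`) has `dim K' ≥ n² - M`, and
`y₀ ∉ K'` because `c L(y₀) = c N - c A(0) = -c A(0) ≠ 0`; so `W := K' ⊕ K y₀` has
`dim W ≥ n² - M + 1`.
(3) ISOTROPY: after the row operation `B = V A(X + y₀)` (`V` invertible with row `i₀` equal to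
`c`) the row `i₀` of `B` vanishes at the origin and `det B = det V · per(X + y₀)`; the closed form of
the Hessian and gradient of `det B` at the origin (toolkit file `…HessianToolkit.lean`) shows that the Hessian form
`H = Hess per(y₀)` vanishes on `K' × K'` and that `∇per(y₀) ⊥ K'`; Euler's identities give
`y₀ᵀ H v = (n-1) ∇per(y₀) ⬝ v = 0` for `v ∈ K'` and `y₀ᵀ H y₀ = n(n-1) per(y₀) = 0`.  So `W` is
totally isotropic for `H`, which is non-degenerate (Mignon–Ressayre: `hess0_transl_mrPoint_perPoly`,
`rank_mrHess`), whence `2 dim W ≤ n²`.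
(4) `2(n² - M + 1) ≤ n²`, i.e. `n² + 2 ≤ 2M`.

Regularity is used once (at the origin) and only through the dimension of a left kernel; no
generic point, no Nullstellensatz, no irreducibility of `per` is needed.
-/

noncomputable section

-- single-conjunct layout: Sub = Summit, duplicated namespace component intended
set_option linter.dupNamespace false

namespace Summit.ValiantsHypothesis.ValiantsHypothesis.Theorems.RefutationDegreeBeyondHessianSos

open Literature.Computability.AlgebraicComplexity MvPolynomial Matrix Module

section Core

variable {K : Type*} [Field K] [CharZero K]

-- 2026-08-16 (two consecutive fullbuilds: "deterministic timeout, 200000 heartbeats" at l.287/289 of this ~215-line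
-- proof under `lake build`; NOT reproducible on the farm, whole file rc 0 in 21 s): double the budget for this decl.
set_option maxHeartbeats 400000 in
/-- **Core of the `+1` argument.** Let `A` be an affine determinantal representation of
`per_{p+3}` of size `M`, let `κ ≠ 0` span the left kernel of `A(0)` and suppose
`κ A(y₀) ≠ 0` at the Mignon–Ressayre point `y₀`.  Then `(p+3)² + 2 ≤ 2M`.

Proof: translate to `y₀`; a left-kernel vector `c` of `N = A(y₀)` is not in the left kernel of
`A(0)` (von zur Gathen regularity: that kernel is the line `K κ`, and `κ N ≠ 0`); the kernel
flat `K' = {v : c L(v) = 0}` has `dim K' ≥ (p+3)² - M` and does not contain `y₀`; the Hessian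
form of `per` at `y₀` (non-degenerate, Mignon–Ressayre) vanishes identically on
`W = K' ⊕ K y₀` (Laplace structure of the Hessian of a determinant along a row vanishing at the
point, plus Euler's identities), so `2 dim W ≤ (p+3)²`. -/
theorem sq_add_two_le_two_mul_of_vecMul_ne_zero {p M : ℕ}
    (A : Matrix (Fin M) (Fin M) (MvPolynomial (Fin (p + 3) × Fin (p + 3)) K))
    (hA : IsAffineDetRepr (perPoly (Fin (p + 3)) K) A) (κ : Fin M → K) (hκ0 : κ ≠ 0)
    (hκA : κ ᵥ* A.map constantCoeff = 0)
    (hκy : κ ᵥ* A.map (eval (mrPoint K p)) ≠ 0) : (p + 3) ^ 2 + 2 ≤ 2 * M := by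
  classical
  obtain ⟨hdeg, hdet⟩ := hA
  cases M with
  | zero => exact absurd (Subsingleton.elim κ 0) hκ0
  | succ m =>
  set y₀ : Fin (p + 3) × Fin (p + 3) → K := mrPoint K p with hy₀
  set per : MvPolynomial (Fin (p + 3) × Fin (p + 3)) K := perPoly (Fin (p + 3)) K with hper
  have hhom : per.IsHomogeneous (p + 3) := by
    simpa [hper] using (perPoly_isHomogeneous (n := Fin (p + 3)) (k := K))
  -- the translated representation
  set A' : Matrix (Fin (m + 1)) (Fin (m + 1)) (MvPolynomial (Fin (p + 3) × Fin (p + 3)) K) :=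
    (transl y₀).mapMatrix A with hA'
  have hA'deg : ∀ i j, (A' i j).totalDegree ≤ 1 := fun i j =>
    (totalDegree_transl_le _ _).trans (hdeg i j)
  have hA'det : A'.det = transl y₀ per := by
    rw [hA', ← AlgHom.map_det, hdet]
  -- `N = A'(0) = A(y₀)` is singular
  set N : Matrix (Fin (m + 1)) (Fin (m + 1)) K := A'.map constantCoeff with hN
  have hNA : N = A.map (eval y₀) := by
    ext i j
    simp [hN, hA', constantCoeff_transl]
  have hNdet : N.det = 0 := by
    rw [hN, ← RingHom.mapMatrix_apply, ← RingHom.map_det, hA'det, constantCoeff_transl, hper,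
      hy₀, eval_mrPoint_perPoly]
  obtain ⟨c, hc0, hcN⟩ := Matrix.exists_vecMul_eq_zero_iff.mpr hNdet
  -- the constant part `A₀ = A(0)` and regularity: `c A₀ ≠ 0`
  set A₀ : Matrix (Fin (m + 1)) (Fin (m + 1)) K := A.map constantCoeff with hA₀
  have hcA₀ : c ᵥ* A₀ ≠ 0 := by
    intro hc
    have hreg := AlperBogartVelasco.le_rank_map_eval_add_one (K := K) two_ne_zero
      (show 3 ≤ p + 3 by omega) A hdet 0
    rw [MvPolynomial.eval_zero] at hreg
    change m + 1 ≤ A₀.rank + 1 at hreg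
    have hker : finrank K (LinearMap.ker A₀ᵀ.mulVecLin) ≤ 1 := by
      have h1 := LinearMap.finrank_range_add_finrank_ker A₀ᵀ.mulVecLin
      rw [finrank_fintype_fun_eq_card, Fintype.card_fin] at h1
      have h2 : finrank K (LinearMap.range A₀ᵀ.mulVecLin) = A₀.rank := by
        rw [← Matrix.rank_transpose]; rfl
      rw [h2] at h1
      omega
    have hmem : ∀ x : Fin (m + 1) → K, x ᵥ* A₀ = 0 → x ∈ LinearMap.ker A₀ᵀ.mulVecLin := by
      intro x hx
      rw [LinearMap.mem_ker, Matrix.mulVecLin_apply, mulVec_transpose]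
      exact hx
    obtain ⟨w, hw⟩ := finrank_le_one_iff.mp hker
    obtain ⟨t₁, ht₁⟩ := hw ⟨κ, hmem κ hκA⟩
    obtain ⟨t₂, ht₂⟩ := hw ⟨c, hmem c hc⟩
    have e₁ : κ = t₁ • (w : Fin (m + 1) → K) := by
      simpa using (congr_arg Subtype.val ht₁).symm
    have e₂ : c = t₂ • (w : Fin (m + 1) → K) := by
      simpa using (congr_arg Subtype.val ht₂).symm
    have ht₂0 : t₂ ≠ 0 := by
      rintro rfl
      rw [zero_smul] at e₂
      exact hc0 e₂
    apply hκy
    rw [← hNA, e₁, smul_vecMul, show (w : Fin (m + 1) → K) = t₂⁻¹ • c by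
      rw [e₂, smul_smul, inv_mul_cancel₀ ht₂0, one_smul], smul_vecMul, hcN, smul_zero, smul_zero]
  -- the row operation making the row `i₀` vanish at `y₀`
  obtain ⟨i₀, hi₀⟩ := Function.ne_iff.mp hc0
  set V : Matrix (Fin (m + 1)) (Fin (m + 1)) K := (1 : Matrix _ _ K).updateRow i₀ c with hV
  have hVdet : V.det = c i₀ := by
    have hc : c = ∑ l, c l • (1 : Matrix (Fin (m + 1)) (Fin (m + 1)) K) l := by
      ext j
      simp [Finset.sum_apply, Matrix.one_apply]
    rw [hV]
    conv_lhs => rw [hc]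
    rw [Matrix.det_updateRow_sum, Matrix.det_one, smul_eq_mul, mul_one]
  have hVdet0 : V.det ≠ 0 := by rw [hVdet]; exact hi₀
  set B : Matrix (Fin (m + 1)) (Fin (m + 1)) (MvPolynomial (Fin (p + 3) × Fin (p + 3)) K) :=
    V.map (C : K →+* MvPolynomial _ K) * A' with hB
  have hBdet : B.det = C V.det * A'.det := by
    rw [hB, Matrix.det_mul, ← RingHom.mapMatrix_apply, ← RingHom.map_det]
  have hBdeg : ∀ i j, (B i j).totalDegree ≤ 1 := by
    intro i j
    rw [hB, Matrix.mul_apply]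
    refine totalDegree_finsetSum_le fun l _ => ?_
    rw [Matrix.map_apply]
    refine (totalDegree_mul _ _).trans ?_
    rw [totalDegree_C, zero_add]
    exact hA'deg l j
  have hBrow : ∀ j, B i₀ j = ∑ l, C (c l) * A' l j := by
    intro j
    rw [hB, Matrix.mul_apply]
    simp [hV, Matrix.updateRow_self]
  have hBcc : ∀ j, constantCoeff (B i₀ j) = 0 := by
    intro j
    have h := congrFun hcN j
    change ∑ l, c l * N l j = 0 at h
    rw [hBrow j, map_sum]
    simp only [map_mul, constantCoeff_C]
    simpa [hN] using h
  -- the linear parts of the row `i₀`: `a_j ⬝ v = (c (A(v) - A₀)) j`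
  set β : Matrix (Fin (m + 1)) (Fin (p + 3) × Fin (p + 3)) K :=
    Matrix.of fun j s => ∑ l, c l * coeff (Finsupp.single s 1) (A l j) with hβ
  have hlin : ∀ j, linPart (B i₀ j) = fun s => β j s := by
    intro j
    ext s
    rw [linPart_apply, hBrow j, map_sum, map_sum, hβ, Matrix.of_apply]
    refine Finset.sum_congr rfl fun l _ => ?_
    rw [Derivation.leibniz, pderiv_C, smul_zero, add_zero, smul_eq_mul, map_mul, constantCoeff_C]
    congr 1
    rw [hA', AlgHom.mapMatrix_apply, Matrix.map_apply, pderiv_transl, constantCoeff_transl,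
      AlperBogartVelasco.pderiv_eq_C_coeff (hdeg l j), eval_C]
  have hβv : ∀ v, c ᵥ* A.map (eval v) = c ᵥ* A₀ + β *ᵥ v := fun v => by
    rw [hβ, hA₀]; exact EvenTransfer.vecMul_map_eval A hdeg c v
  -- the kernel flat `K' = {v : c L(v) = 0}`
  set T : (Fin (p + 3) × Fin (p + 3) → K) →ₗ[K] (Fin (m + 1) → K) := β.mulVecLin with hT
  set K' : Submodule K (Fin (p + 3) × Fin (p + 3) → K) := LinearMap.ker T with hK'
  have hK'mem : ∀ v, v ∈ K' ↔ β *ᵥ v = 0 := fun v => by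
    rw [hK', LinearMap.mem_ker, hT, Matrix.mulVecLin_apply]
  have hK'lin : ∀ v ∈ K', ∀ j, linPart (B i₀ j) ⬝ᵥ v = 0 := by
    intro v hv j
    rw [hlin j]
    exact congrFun ((hK'mem v).1 hv) j
  -- its dimension
  set n2 : ℕ := Fintype.card (Fin (p + 3) × Fin (p + 3)) with hn2
  have hn2' : n2 = (p + 3) ^ 2 := by rw [hn2, Fintype.card_prod, Fintype.card_fin, sq]
  have hK'dim : n2 ≤ finrank K K' + (m + 1) := by
    have h1 := LinearMap.finrank_range_add_finrank_ker T
    rw [finrank_fintype_fun_eq_card] at h1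
    have h2 : finrank K (LinearMap.range T) ≤ m + 1 := by
      calc finrank K (LinearMap.range T) ≤ finrank K (Fin (m + 1) → K) :=
            Submodule.finrank_le _
        _ = m + 1 := by rw [finrank_fintype_fun_eq_card, Fintype.card_fin]
    rw [← hK'] at h1
    omega
  -- `y₀ ∉ K'`
  have hy₀K' : y₀ ∉ K' := by
    intro hy
    have h0 : β *ᵥ y₀ = 0 := (hK'mem y₀).1 hy
    have h := hβv y₀
    rw [h0, add_zero, ← hNA, hcN] at h
    exact hcA₀ h.symm
  have hy₀0 : y₀ ≠ 0 := fun h => by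
    have h1 := congrFun h ((0 : Fin (p + 3)), (1 : Fin (p + 3)))
    rw [hy₀, mrPoint_apply] at h1
    simp at h1
  -- the Hessian form of `det B = det V · per(X + y₀)` at the origin
  set H : Matrix (Fin (p + 3) × Fin (p + 3)) (Fin (p + 3) × Fin (p + 3)) K := hess0 B.det with hH
  have hHG : H = V.det • hess0 (transl y₀ per) := by rw [hH, hBdet, hess0_C_mul, hA'det]
  have hHt : Hᵀ = H := by
    ext s t
    rw [Matrix.transpose_apply, hH, hess0_apply, hess0_apply, pderiv_pderiv_comm]
  have hHdet : H.det ≠ 0 := by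
    rw [hHG, hper, hy₀, hess0_transl_mrPoint_perPoly, smul_smul, Matrix.det_smul]
    refine mul_ne_zero (pow_ne_zero _ (mul_ne_zero hVdet0 ?_)) ?_
    · exact_mod_cast Nat.factorial_ne_zero p
    · have hU : IsUnit (mrHess K p) :=
        Matrix.mulVec_injective_iff_isUnit.mp mrHess_mulVec_injective
      exact ((Matrix.isUnit_iff_isUnit_det _).mp hU).ne_zero
  let Bf : LinearMap.BilinForm K (Fin (p + 3) × Fin (p + 3) → K) := Matrix.toBilin' H
  have hBf : ∀ x z, Bf x z = x ⬝ᵥ (H *ᵥ z) := fun x z => Matrix.toBilin'_apply' H x z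
  have hnd : Bf.Nondegenerate :=
    LinearMap.BilinForm.nondegenerate_toBilin'_of_det_ne_zero' H hHdet
  -- its values against `y₀` (Euler) and on the kernel flat (Laplace)
  have hGv : ∀ v, y₀ ⬝ᵥ (H *ᵥ v) =
      V.det * (((p + 3 - 1 : ℕ) : K) * (linPart (transl y₀ per) ⬝ᵥ v)) := by
    intro v
    rw [hHG, smul_mulVec, dotProduct_smul, smul_eq_mul, dotProduct_hess0_transl_mulVec hhom]
  have hlinB : linPart B.det = V.det • linPart (transl y₀ per) := by
    rw [hBdet, linPart_C_mul, hA'det]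
  have hgrad : ∀ v ∈ K', linPart (transl y₀ per) ⬝ᵥ v = 0 := by
    intro v hv
    have h := linPart_det_dotProduct_eq_zero B i₀ hBcc v (hK'lin v hv)
    rw [hlinB, smul_dotProduct, smul_eq_mul] at h
    exact (mul_eq_zero.1 h).resolve_left hVdet0
  have hyv : ∀ v ∈ K', Bf y₀ v = 0 := by
    intro v hv
    rw [hBf, hGv, hgrad v hv, mul_zero, mul_zero]
  have hvy : ∀ v ∈ K', Bf v y₀ = 0 := by
    intro v hv
    rw [hBf, dotProduct_mulVec, ← mulVec_transpose, hHt, dotProduct_comm, ← hBf]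
    exact hyv v hv
  have hyy : Bf y₀ y₀ = 0 := by
    rw [hBf, hGv, linPart_transl_dotProduct_self hhom, hper, hy₀, eval_mrPoint_perPoly]
    simp
  have hvv : ∀ v ∈ K', ∀ v' ∈ K', Bf v v' = 0 := by
    intro v hv v' hv'
    rw [hBf]
    exact dotProduct_hess0_det_mulVec_eq_zero B i₀ (hBdeg i₀) hBcc v v' (hK'lin v hv)
      (hK'lin v' hv')
  -- `W = K' ⊕ K y₀` is totally isotropic
  set W : Submodule K (Fin (p + 3) × Fin (p + 3) → K) := K' ⊔ K ∙ y₀ with hW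
  have hiso : ∀ w ∈ W, ∀ w' ∈ W, Bf w w' = 0 := by
    intro w hw w' hw'
    obtain ⟨k, hk, u, hu, rfl⟩ := Submodule.mem_sup.1 hw
    obtain ⟨k', hk', u', hu', rfl⟩ := Submodule.mem_sup.1 hw'
    obtain ⟨t, rfl⟩ := Submodule.mem_span_singleton.1 hu
    obtain ⟨t', rfl⟩ := Submodule.mem_span_singleton.1 hu'
    simp only [map_add, map_smul, LinearMap.add_apply, LinearMap.smul_apply, smul_eq_mul,
      hvv k hk k' hk', hyv k' hk', hvy k hk, hyy, mul_zero, add_zero]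
  have hle : W ≤ Bf.orthogonal W := by
    intro w hw
    rw [LinearMap.BilinForm.mem_orthogonal_iff]
    intro n hn
    exact hiso n hn w hw
  have h1 := Submodule.finrank_mono hle
  rw [LinearMap.BilinForm.finrank_orthogonal hnd W, finrank_fintype_fun_eq_card] at h1
  have h2 : finrank K W ≤ n2 := by
    have h := Submodule.finrank_le W
    rwa [finrank_fintype_fun_eq_card] at h
  have hWdim : finrank K W = finrank K K' + 1 := by
    have hdisj : K' ⊓ (K ∙ y₀) = ⊥ :=
      disjoint_iff.1 ((Submodule.disjoint_span_singleton' hy₀0).2 hy₀K')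
    have hsum := Submodule.finrank_sup_add_finrank_inf_eq K' (K ∙ y₀)
    rw [hdisj, finrank_bot, add_zero, finrank_span_singleton hy₀0] at hsum
    rw [hW, hsum]
  rw [← hn2']
  omega

/-- **Mignon–Ressayre plus one.** Over a field of characteristic zero, an affine determinantal
representation of `per_{p+3}` of size `M` has `(p+3)² + 2 ≤ 2M`; that is
`dc(per_n) ≥ ⌈n²/2⌉ + 1` for `n ≥ 3` — one more than the Hessian-rank bound `n² ≤ 2 dc(per_n)`
of Mignon–Ressayre (`sq_le_two_mul_of_hasDetRepr_perPoly`). -/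
theorem sq_add_two_le_two_mul_of_hasDetRepr_perPoly {p M : ℕ}
    (h : HasDetRepr (perPoly (Fin (p + 3)) K) M) : (p + 3) ^ 2 + 2 ≤ 2 * M := by
  classical
  obtain ⟨A, hdeg, hdet⟩ := h
  have hM : 1 ≤ M := by
    rcases Nat.eq_zero_or_pos M with rfl | hM
    · exfalso
      have h0 := constantCoeff_perPoly K (show 1 ≤ p + 3 by omega)
      rw [← hdet, Matrix.det_isEmpty, map_one] at h0
      exact one_ne_zero h0
    · exact hM
  set A₀ : Matrix (Fin M) (Fin M) K := A.map constantCoeff with hA₀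
  have hA₀det : A₀.det = 0 := by
    rw [hA₀, ← RingHom.mapMatrix_apply, ← RingHom.map_det, hdet,
      constantCoeff_perPoly K (show 1 ≤ p + 3 by omega)]
  obtain ⟨κ, hκ0, hκA⟩ := Matrix.exists_vecMul_eq_zero_iff.mpr hA₀det
  obtain ⟨a, ha⟩ := EvenTransfer.exists_vecMul_map_eval_ne_zero A ⟨hdeg, hdet⟩ κ hκ0 hκA
  set e : Fin (p + 3) ≃ Fin (p + 3) := Equiv.swap 0 a with he
  set Ae : Matrix (Fin M) (Fin M) (MvPolynomial (Fin (p + 3) × Fin (p + 3)) K) :=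
    (rename (Prod.map e e)).mapMatrix A with hAe
  have hAe_aff : IsAffineDetRepr (perPoly (Fin (p + 3)) K) Ae := by
    refine ⟨fun i j => ?_, ?_⟩
    · rw [hAe, AlgHom.mapMatrix_apply, Matrix.map_apply]
      exact (totalDegree_rename_le _ _).trans (hdeg i j)
    · rw [hAe, ← AlgHom.map_det, hdet, rename_perPoly_equiv]
  have hAe0 : Ae.map constantCoeff = A₀ := by
    ext i j
    simp [hAe, hA₀, constantCoeff_rename]
  have hAey : Ae.map (eval (mrPoint K p)) = A.map (eval (mrPoint K p ∘ Prod.map e e)) := by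
    ext i j
    simp [hAe, eval_rename]
  refine sq_add_two_le_two_mul_of_vecMul_ne_zero Ae hAe_aff κ hκ0 (by rw [hAe0]; exact hκA) ?_
  rw [hAey, he]
  exact ha

/-- Floor form of the bound: `⌊n²/2⌋ + 1 + (n mod 2) ≤ M` for every affine determinantal
representation of `per_n` of size `M`, `n ≥ 3`. -/
theorem sq_div_two_add_one_le_of_hasDetRepr_perPoly {n M : ℕ} (hn : 3 ≤ n)
    (h : HasDetRepr (perPoly (Fin n) K) M) : n ^ 2 / 2 + 1 + n % 2 ≤ M := by
  obtain ⟨p, rfl⟩ : ∃ p, n = p + 3 := ⟨n - 3, by omega⟩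
  have h1 := sq_add_two_le_two_mul_of_hasDetRepr_perPoly h
  have hpar : (p + 3) ^ 2 % 2 = (p + 3) % 2 := by
    rw [sq, Nat.mul_mod]
    rcases Nat.mod_two_eq_zero_or_one (p + 3) with h0 | h0 <;> simp [h0]
  omega

/-- **The semantic half of the crux for odd `n`**: for odd `n ≥ 3` the permanent `per_n` has
no affine determinantal representation of size `⌊n²/2⌋ + 1` — the system `Rep(n, ⌊n²/2⌋+1)` of
route `RefutationDegree` is infeasible. -/
theorem not_hasDetRepr_perPoly_sq_div_two_add_one_of_odd {n : ℕ} (hn : 3 ≤ n)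
    (hodd : n % 2 = 1) : ¬ HasDetRepr (perPoly (Fin n) K) (n ^ 2 / 2 + 1) := fun h => by
  have := sq_div_two_add_one_le_of_hasDetRepr_perPoly hn h
  omega

end Core

/-- **Stub `stub_core` of the lead skeleton `Cruxes/BeyondHessianSos/Lines/Sketch.lean`
(registered signature, over `ℂ`)**: the core count, `sq_add_two_le_two_mul_of_vecMul_ne_zero`. -/
theorem stub_core {p M : ℕ}
    (A : Matrix (Fin M) (Fin M) (MvPolynomial (Fin (p + 3) × Fin (p + 3)) ℂ))
    (hA : IsAffineDetRepr (perPoly (Fin (p + 3)) ℂ) A) (κ : Fin M → ℂ) (hκ0 : κ ≠ 0)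
    (hκA : Matrix.vecMul κ (A.map MvPolynomial.constantCoeff) = 0)
    (hκy : Matrix.vecMul κ (A.map (MvPolynomial.eval (mrPoint ℂ p))) ≠ 0) :
    (p + 3) ^ 2 + 2 ≤ 2 * M :=
  sq_add_two_le_two_mul_of_vecMul_ne_zero A hA κ hκ0 hκA hκy

/-- **Stub `stub_oddInfeasible` (earlier skeleton revision; kept as the crux-facing corollary)**:
for odd `n ≥ 3`, `per_n` has no affine determinantal representation of size `⌊n²/2⌋ + 1` over
`ℂ` — the semantic half of `BeyondHessianSos` on the odd subsequence. -/
theorem stub_oddInfeasible (n : ℕ) (hn : 3 ≤ n) (hodd : n % 2 = 1) :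
    ¬ HasDetRepr (perPoly (Fin n) ℂ) (n ^ 2 / 2 + 1) :=
  not_hasDetRepr_perPoly_sq_div_two_add_one_of_odd hn hodd

/-- **`dc(per_n) ≥ ⌊n²/2⌋ + 1 + (n mod 2) = ⌈n²/2⌉ + 1` over `ℂ`** for every `n ≥ 3`
(the infimum is attained by Valiant universality, `exists_hasDetRepr_holds`). -/
theorem sq_div_two_add_one_le_determinantalComplexity_perPoly {n : ℕ} (hn : 3 ≤ n) :
    n ^ 2 / 2 + 1 + n % 2 ≤ determinantalComplexity (perPoly (Fin n) ℂ) := by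
  have hne : {M : ℕ | HasDetRepr (perPoly (Fin n) ℂ) M}.Nonempty := exists_hasDetRepr_holds _
  exact sq_div_two_add_one_le_of_hasDetRepr_perPoly hn (Nat.sInf_mem hne)


end Summit.ValiantsHypothesis.ValiantsHypothesis.Theorems.RefutationDegreeBeyondHessianSos
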